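import Summits.Ventures.Crystal3D.Theorems.StickyWulffConstantGenericWallFloorTwinFrame
import HarnessLib

/-!
# The STACK WALK (translate rule) of the general-filling ledger: definitions

HONEST FRAMING. Part of the venture `Summits/Ventures/Crystal3D` (cell `crystal3d-full`), helper
`--supports` the crux `GenericWallFloor` (stmt-Ventures-19480) of `route-Ventures-StickyWulffConstant`,
registered line `WallLedgerG`, open stub `stub_twoSlabAdhesion` (general fillings).  The chain ledger
(`…ChainLedgerSealed`) stops every steep lattice line at its first exit and books a twin-capped exit as the
residual `#TC`; decorative coherent lamellae make `#TC` of areal size at lineal cost.  The STACK WALK continues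
the line THROUGH exact twin caps:

* a walker is a ball `y ∈ X` with a STACK of entries `(frame F, direction slot v, entry normal m)`; it is
  CERTIFIED (its predecessor `y − F v` carries the full `F`-shell, or is an exact cap of which `y` is a
  capper), so the C12-55 row applies to it;
* FULL step: if all twelve `F`-slots of `y` are occupied, move to `y + F v`;
* CAP step: if `y` is an exact twin cap of `F` with normal `n` and `⟪F v, n⟫ = √(2/3)`: when `n` equals the
  top entry's normal `m` (the lamella CLOSES) POP the stack and step along the previous direction (a capper of
  this cap); otherwise PUSH the twin frame `R_n ∘ F` with the best-rising capper slot and the normal `n`;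
* otherwise STOP (by `ExactOnly` of C12-55 the ball is then unsaturated: it pays).

Every step rises by `≥ 3/8` in the chosen vertical `z` (`…CapperRiseSharp`, `…TwinNormals`), so the walk ends
after `O(h)` steps with lateral drift `≤ 8/3 ·` rise.  This file only DEFINES the objects (`WalkEntry`,
`twinFrame`, `IsOrientedCap`, `bestCapper`, `capMove`, `walkStep`, `walkRun`, `walkEnd`); the invariant and the
pay-off theorem are in `…StackWalk`, the two-slab inequality in `…StackLedger`.

WHAT THIS IS NOT: definitions only; not the stub; F-C1 not moved.
-/

noncomputable section

namespace Summit.Ventures.Crystal3D.Theorems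

open Finset
open scoped InnerProductSpace

/-- One level of the walker's stack: the current FRAME, the DIRECTION slot (an element of `fccSlots`, moved by
the frame), and the ENTRY NORMAL through which this frame was entered (ignored for the bottom entry). -/
structure WalkEntry where
  /-- the lattice frame of this level -/
  frame : EuclideanSpace ℝ (Fin 3) ≃ₗᵢ[ℝ] EuclideanSpace ℝ (Fin 3)
  /-- the direction slot (in `fccSlots`; the walker moves by `frame dir`) -/
  dir : EuclideanSpace ℝ (Fin 3)
  /-- the unit `{111}` normal of the twin plane through which this frame was entered -/
  nrm : EuclideanSpace ℝ (Fin 3)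

/-- The TWIN FRAME `x ↦ A x − 2⟪A x, n⟫ n` of `A` across the plane `n^⊥` (for a unit `n`), as a linear
isometry: `A` followed by Mathlib's reflection in `(ℝ ∙ n)ᗮ`. -/
def twinFrame (A : EuclideanSpace ℝ (Fin 3) ≃ₗᵢ[ℝ] EuclideanSpace ℝ (Fin 3)) (n : EuclideanSpace ℝ (Fin 3)) :
    EuclideanSpace ℝ (Fin 3) ≃ₗᵢ[ℝ] EuclideanSpace ℝ (Fin 3) :=
  A.trans (ℝ ∙ n)ᗮ.reflection

/-- The twin frame is the mirror of `A`: `twinFrame A n x = A x − 2⟪A x, n⟫ n` for a unit `n`. -/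
theorem twinFrame_apply (A : EuclideanSpace ℝ (Fin 3) ≃ₗᵢ[ℝ] EuclideanSpace ℝ (Fin 3))
    {n : EuclideanSpace ℝ (Fin 3)} (hn : ‖n‖ = 1) (x : EuclideanSpace ℝ (Fin 3)) :
    twinFrame A n x = A x - (2 * ⟪A x, n⟫_ℝ) • n := by
  show (ℝ ∙ n)ᗮ.reflection (A x) = _
  rw [reflection_unit_apply hn]

/-- `y ∈ X` is an EXACT TWIN CAP of the frame `F`, ORIENTED along the slot `v`, with unit menu normal `n`:
`⟪F v, n⟫ = √(2/3)` (the arrival direction is positive), every slot `y + F w` with `⟪F w, n⟫ ≤ 0` is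
occupied, every slot with `⟪F w, n⟫ > 0` is empty and its mirror image `y − F w + 2⟪F w, n⟫ n` (a CAPPER)
is occupied. -/
def IsOrientedCap (X : Finset (EuclideanSpace ℝ (Fin 3)))
    (F : EuclideanSpace ℝ (Fin 3) ≃ₗᵢ[ℝ] EuclideanSpace ℝ (Fin 3)) (y v n : EuclideanSpace ℝ (Fin 3)) : Prop :=
  ‖n‖ = 1 ∧
  (∀ w ∈ fccSlots, ⟪F w, n⟫_ℝ = 0 ∨ ⟪F w, n⟫_ℝ = Real.sqrt (2 / 3) ∨ ⟪F w, n⟫_ℝ = -Real.sqrt (2 / 3)) ∧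
  ⟪F v, n⟫_ℝ = Real.sqrt (2 / 3) ∧
  (∀ w ∈ fccSlots, ⟪F w, n⟫_ℝ ≤ 0 → y + F w ∈ X) ∧
  (∀ w ∈ fccSlots, 0 < ⟪F w, n⟫_ℝ → y + F w ∉ X ∧ y - F w + (2 * ⟪F w, n⟫_ℝ) • n ∈ X)

/-- The BEST-RISING CAPPER SLOT of the (twin) frame `F'` for the normal `n` and the vertical `z`: a slot `q`
with `⟪F' q, n⟫ > 0` maximising the height `⟪F' q, z⟫` (some maximiser, by choice; `0` if there is none). -/
def bestCapper (F' : EuclideanSpace ℝ (Fin 3) ≃ₗᵢ[ℝ] EuclideanSpace ℝ (Fin 3)) (n z : EuclideanSpace ℝ (Fin 3)) :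
    EuclideanSpace ℝ (Fin 3) := by
  classical
  exact if h : (fccSlots.filter fun q => 0 < ⟪F' q, n⟫_ℝ).Nonempty then
    Classical.choose (Finset.exists_max_image _ (fun q => ⟪F' q, z⟫_ℝ) h)
  else 0

/-- The PUSH move at an exact cap of the top frame with normal `n`: enter the twin frame along its best-rising
capper and record `n` as the entry normal. -/
def pushMove (z y : EuclideanSpace ℝ (Fin 3)) (e : WalkEntry) (rest : List WalkEntry) (n : EuclideanSpace ℝ (Fin 3)) :
    EuclideanSpace ℝ (Fin 3) × List WalkEntry :=
  (y + twinFrame e.frame n (bestCapper (twinFrame e.frame n) n z),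
    ⟨twinFrame e.frame n, bestCapper (twinFrame e.frame n) n z, n⟩ :: e :: rest)

/-- The CAP move: POP when the cap normal `n` is the top entry's own entry normal and there is a level below
(the lamella closes: step along the previous level's direction, a capper of this cap), else PUSH. -/
def capMove (z y : EuclideanSpace ℝ (Fin 3)) (e : WalkEntry) (rest : List WalkEntry) (n : EuclideanSpace ℝ (Fin 3)) :
    EuclideanSpace ℝ (Fin 3) × List WalkEntry := by
  classical
  exact match rest with
  | [] => pushMove z y e [] n
  | e' :: rest' => if n = e.nrm then (y + e'.frame e'.dir, e' :: rest') else pushMove z y e (e' :: rest') n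

/-- ONE STEP of the stack walk in the configuration `X` with vertical `z` (see the module docstring):
`none` = the walker stops here. -/
def walkStep (X : Finset (EuclideanSpace ℝ (Fin 3))) (z : EuclideanSpace ℝ (Fin 3)) :
    EuclideanSpace ℝ (Fin 3) × List WalkEntry → Option (EuclideanSpace ℝ (Fin 3) × List WalkEntry) := by
  classical
  exact fun s => match s with
  | (_, []) => none
  | (y, e :: rest) =>
    if (∀ w ∈ fccSlots, y + e.frame w ∈ X) then some (y + e.frame e.dir, e :: rest)
    else if h : ∃ n, IsOrientedCap X e.frame y e.dir n then some (capMove z y e rest (Classical.choose h))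
    else none

/-- The walk run for `k` steps of fuel (it stays put once it has stopped). -/
def walkRun (X : Finset (EuclideanSpace ℝ (Fin 3))) (z : EuclideanSpace ℝ (Fin 3)) :
    ℕ → EuclideanSpace ℝ (Fin 3) × List WalkEntry → EuclideanSpace ℝ (Fin 3) × List WalkEntry
  | 0, s => s
  | k + 1, s => match walkStep X z s with
    | none => s
    | some s' => walkRun X z k s'

/-- The END BALL of the walk started at `(y₀, stk₀)` with fuel `N`. -/
def walkEnd (X : Finset (EuclideanSpace ℝ (Fin 3))) (z : EuclideanSpace ℝ (Fin 3)) (N : ℕ)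
    (y₀ : EuclideanSpace ℝ (Fin 3)) (stk₀ : List WalkEntry) : EuclideanSpace ℝ (Fin 3) :=
  (walkRun X z N (y₀, stk₀)).1

/-! ### Unfolding lemmas -/

/-- The best capper is a positive slot of maximal height (when positive slots exist). -/
theorem bestCapper_spec (F' : EuclideanSpace ℝ (Fin 3) ≃ₗᵢ[ℝ] EuclideanSpace ℝ (Fin 3)) (n z : EuclideanSpace ℝ (Fin 3))
    (h : (fccSlots.filter fun q => 0 < ⟪F' q, n⟫_ℝ).Nonempty) :
    bestCapper F' n z ∈ (fccSlots.filter fun q => 0 < ⟪F' q, n⟫_ℝ) ∧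
      ∀ q' ∈ (fccSlots.filter fun q => 0 < ⟪F' q, n⟫_ℝ), ⟪F' q', z⟫_ℝ ≤ ⟪F' (bestCapper F' n z), z⟫_ℝ := by
  classical
  unfold bestCapper
  rw [dif_pos h]
  exact Classical.choose_spec (Finset.exists_max_image _ (fun q => ⟪F' q, z⟫_ℝ) h)

/-- The cap move with nothing below: push. -/
@[simp] theorem capMove_nil (z y : EuclideanSpace ℝ (Fin 3)) (e : WalkEntry) (n : EuclideanSpace ℝ (Fin 3)) :
    capMove z y e [] n = pushMove z y e [] n := rfl

/-- The cap move when the normal closes the top level: pop. -/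
theorem capMove_cons_of_eq (z y : EuclideanSpace ℝ (Fin 3)) (e e' : WalkEntry) (rest' : List WalkEntry)
    {n : EuclideanSpace ℝ (Fin 3)} (h : n = e.nrm) :
    capMove z y e (e' :: rest') n = (y + e'.frame e'.dir, e' :: rest') := by
  classical
  show (if n = e.nrm then (y + e'.frame e'.dir, e' :: rest') else pushMove z y e (e' :: rest') n) = _
  rw [if_pos h]

/-- The cap move when the normal is new: push. -/
theorem capMove_cons_of_ne (z y : EuclideanSpace ℝ (Fin 3)) (e e' : WalkEntry) (rest' : List WalkEntry)
    {n : EuclideanSpace ℝ (Fin 3)} (h : n ≠ e.nrm) :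
    capMove z y e (e' :: rest') n = pushMove z y e (e' :: rest') n := by
  classical
  show (if n = e.nrm then (y + e'.frame e'.dir, e' :: rest') else pushMove z y e (e' :: rest') n) = _
  rw [if_neg h]

/-- The step of a FULL ball: straight on. -/
theorem walkStep_of_full (X : Finset (EuclideanSpace ℝ (Fin 3))) (z y : EuclideanSpace ℝ (Fin 3)) (e : WalkEntry)
    (rest : List WalkEntry) (hfull : ∀ w ∈ fccSlots, y + e.frame w ∈ X) :
    walkStep X z (y, e :: rest) = some (y + e.frame e.dir, e :: rest) := by
  classical
  show (if (∀ w ∈ fccSlots, y + e.frame w ∈ X) then some (y + e.frame e.dir, e :: rest)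
    else if h : ∃ n, IsOrientedCap X e.frame y e.dir n then some (capMove z y e rest (Classical.choose h))
    else none) = _
  rw [if_pos hfull]

/-- The step at a CAP: the cap move with the chosen normal. -/
theorem walkStep_of_cap (X : Finset (EuclideanSpace ℝ (Fin 3))) (z y : EuclideanSpace ℝ (Fin 3)) (e : WalkEntry)
    (rest : List WalkEntry) (hnf : ¬ ∀ w ∈ fccSlots, y + e.frame w ∈ X)
    (h : ∃ n, IsOrientedCap X e.frame y e.dir n) :
    walkStep X z (y, e :: rest) = some (capMove z y e rest (Classical.choose h)) := by
  classical
  show (if (∀ w ∈ fccSlots, y + e.frame w ∈ X) then some (y + e.frame e.dir, e :: rest)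
    else if h : ∃ n, IsOrientedCap X e.frame y e.dir n then some (capMove z y e rest (Classical.choose h))
    else none) = _
  rw [if_neg hnf, dif_pos h]

/-- The step of a ball that is neither full nor an oriented cap: stop. -/
theorem walkStep_of_stop (X : Finset (EuclideanSpace ℝ (Fin 3))) (z y : EuclideanSpace ℝ (Fin 3)) (e : WalkEntry)
    (rest : List WalkEntry) (hnf : ¬ ∀ w ∈ fccSlots, y + e.frame w ∈ X)
    (hnc : ¬ ∃ n, IsOrientedCap X e.frame y e.dir n) :
    walkStep X z (y, e :: rest) = none := by
  classical
  show (if (∀ w ∈ fccSlots, y + e.frame w ∈ X) then some (y + e.frame e.dir, e :: rest)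
    else if h : ∃ n, IsOrientedCap X e.frame y e.dir n then some (capMove z y e rest (Classical.choose h))
    else none) = _
  rw [if_neg hnf, dif_neg hnc]

/-- Conversely, a stop means: not full and not an oriented cap. -/
theorem not_full_not_cap_of_walkStep_eq_none (X : Finset (EuclideanSpace ℝ (Fin 3))) (z y : EuclideanSpace ℝ (Fin 3))
    (e : WalkEntry) (rest : List WalkEntry) (h : walkStep X z (y, e :: rest) = none) :
    (¬ ∀ w ∈ fccSlots, y + e.frame w ∈ X) ∧ ¬ ∃ n, IsOrientedCap X e.frame y e.dir n := by
  classical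
  by_cases hfull : ∀ w ∈ fccSlots, y + e.frame w ∈ X
  · rw [walkStep_of_full X z y e rest hfull] at h; exact absurd h (by simp)
  by_cases hcap : ∃ n, IsOrientedCap X e.frame y e.dir n
  · rw [walkStep_of_cap X z y e rest hfull hcap] at h; exact absurd h (by simp)
  exact ⟨hfull, hcap⟩


/-- `walkRun` with no fuel. -/
@[simp] theorem walkRun_zero (X : Finset (EuclideanSpace ℝ (Fin 3))) (z : EuclideanSpace ℝ (Fin 3))
    (s : EuclideanSpace ℝ (Fin 3) × List WalkEntry) : walkRun X z 0 s = s := rfl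

/-- `walkRun` after a stop. -/
theorem walkRun_succ_of_none (X : Finset (EuclideanSpace ℝ (Fin 3))) (z : EuclideanSpace ℝ (Fin 3)) (k : ℕ)
    {s : EuclideanSpace ℝ (Fin 3) × List WalkEntry} (h : walkStep X z s = none) : walkRun X z (k + 1) s = s := by
  rw [walkRun, h]

/-- `walkRun` after a step. -/
theorem walkRun_succ_of_some (X : Finset (EuclideanSpace ℝ (Fin 3))) (z : EuclideanSpace ℝ (Fin 3)) (k : ℕ)
    {s s' : EuclideanSpace ℝ (Fin 3) × List WalkEntry} (h : walkStep X z s = some s') :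
    walkRun X z (k + 1) s = walkRun X z k s' := by
  rw [walkRun, h]

/-- The walk does not move a stopped walker. -/
theorem walkRun_of_none (X : Finset (EuclideanSpace ℝ (Fin 3))) (z : EuclideanSpace ℝ (Fin 3))
    {s : EuclideanSpace ℝ (Fin 3) × List WalkEntry} (h : walkStep X z s = none) : ∀ k, walkRun X z k s = s
  | 0 => rfl
  | k + 1 => walkRun_succ_of_none X z k h

/-- Fuel composes: running `k + 1` steps is running `k` steps and then one more. -/
theorem walkRun_succ' (X : Finset (EuclideanSpace ℝ (Fin 3))) (z : EuclideanSpace ℝ (Fin 3)) :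
    ∀ (k : ℕ) (s : EuclideanSpace ℝ (Fin 3) × List WalkEntry),
      walkRun X z (k + 1) s = walkRun X z 1 (walkRun X z k s)
  | 0, s => rfl
  | k + 1, s => by
    cases h : walkStep X z s with
    | none =>
      rw [walkRun_succ_of_none X z (k + 1) h, walkRun_succ_of_none X z k h, walkRun, h]
    | some s' =>
      rw [walkRun_succ_of_some X z (k + 1) h, walkRun_succ_of_some X z k h]
      exact walkRun_succ' X z k s'

/-- The step at an empty stack. -/
@[simp] theorem walkStep_nil (X : Finset (EuclideanSpace ℝ (Fin 3))) (z y : EuclideanSpace ℝ (Fin 3)) :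
    walkStep X z (y, []) = none := rfl

end Summit.Ventures.Crystal3D.Theorems

end
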